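import Literature.Dynamics.Billiards.SlavedUnstablePlaquesNoGhost

/-!
# Absorption in the two-body toy of the contact-slaved window dynamics (D5): the toy plaque
# through the recorded datum contains a whole segment of distinct window data

Route `UGibbsSRBRigidity` of `AtomisticToContinuum/HydrodynamicLimit`, support item
stmt-AtomisticToContinuum-13992 (`GibbsStatesURegularSlaved`). Helper file (`--supports`) for the
refutation evidence `SyncAbsorption.md`, companion of `…GibbsStatesURegularSlavedSync` (synchronisation
lemma, absorption identity `SlavedSync.reflectVel_fst_absorb`).

In the definer's own acceptance toy `Literature.Dynamics.Billiards.TwoBodyRecord` (one window particle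
`p` with recorded reversed datum `P`, one exterior particle with datum `Q`, one non-grazing contact at
reversed time `s₀`, `SlavedUnstablePlaquesNoGhost`) we exhibit the ABSORBED DATA
`y_b = (P.1 - (s₀ b) • n₀, P.2 + b • n₀)` (`n₀` the recorded contact vector, `|b|` small): the window
particle started from `y_b` reaches the RECORDED space-time contact point at the RECORDED instant `s₀`
with an extra normal velocity `b • n₀`, which the equal-mass law hands to the exterior partner; from
`s₀` on its path COINCIDES with the record. Proved here:

* `SlavedSync.Toy.relPos_absorbed`, `gap_absorbed`, `dist_absorbed_le` — bookkeeping;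
* `SlavedSync.Toy.contactTime_absorbed : R.contactTime y_b = R.s₀` (no early contact: the recorded
  gap grows linearly backwards from `s₀` by the non-grazing margin `κ`, beating the `O(b)` tilt);
* `SlavedSync.Toy.toyTraj_absorbed_eq_recPath` — for `s > s₀` the toy window path from `y_b` IS the
  recorded one (position bookkeeping + the absorption identity);
* `SlavedSync.Toy.absorbed_segment_on_toy_plaque` — headline: for every `b` with
  `|b| ε (s₀ + 1) ≤ δ₀` and `|b| M ε < κ`, the datum `y_b` (≠ `P` when `b ≠ 0`) is the window datum of a
  slaved trajectory of the toy (`IsSlavedTrajectory ε {p} {p, q} (recPath p) z`, `z p 0 = y_b`) whose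
  window path satisfies the exponential-convergence clause of `slavedUnstableSet` in its exact form
  (`∃ r > 0, ∀ᶠ s in atTop, dist (z p s) (recPath p p s) ≤ exp (-(r s))`), indeed coincides with the
  record after `s₀`; and by the toy's uniqueness theorem EVERY slaved trajectory from `y_b` does.

So even in the toy the "unstable set through `P`" rendered by D5's clauses is not `{P}`: it contains
the segment `{y_b}` — one absorbed dimension per exterior contact, the rank drop `2d → 2d - 1` of the
one-contact transfer map of an OPEN window system (evidence file §3). Conversely, in the toy nothing
else converges (after the single contact both paths are free flights, which converge in the sup metric
only if they coincide), so the toy plaque is exactly one-dimensional; that converse is not formalised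
here (it is special to a record with finitely many contacts), the infinite-contact mechanism being the
synchronisation lemma of the companion file.

References: `SlavedUnstablePlaquesNoGhost` (toy API: `contactTime`, `toyTraj`, `recPath`,
`isSlavedTrajectory_toyTraj`, `eq_toyTraj`); folklore.
-/

noncomputable section

open MeasureTheory Set Filter Metric Function Topology
open scoped InnerProductSpace
open Literature.Analysis.FunctionSpaces Literature.Analysis.FluidPDE Literature.Dynamics.Billiards

namespace Summit.AtomisticToContinuum.HydrodynamicLimit.Theorems

namespace SlavedSync.Toy

open Literature.Dynamics.Billiards.TwoBodyRecord

variable {d : Type*} [Fintype d] {R : TwoBodyRecord d}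
  {y : EuclideanSpace ℝ d × EuclideanSpace ℝ d} {b : ℝ}

/-- Relative position of the absorbed datum: the recorded one tilted by `((s - s₀) b) • n₀`. -/
theorem relPos_absorbed (hy : y = (R.P.1 - (R.s₀ * b) • R.n₀, R.P.2 + b • R.n₀)) (s : ℝ) :
    R.relPos y s = R.relPos R.P s + ((s - R.s₀) * b) • R.n₀ := by
  subst hy
  simp only [TwoBodyRecord.relPos]
  module

/-- At the recorded instant the absorbed datum has the RECORDED relative position `n₀`. -/
theorem relPos_absorbed_s₀ (hy : y = (R.P.1 - (R.s₀ * b) • R.n₀, R.P.2 + b • R.n₀)) :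
    R.relPos y R.s₀ = R.n₀ := by
  rw [relPos_absorbed hy, sub_self, zero_mul, zero_smul, add_zero]
  rfl

/-- Gap function of the absorbed datum. -/
theorem gap_absorbed (hy : y = (R.P.1 - (R.s₀ * b) • R.n₀, R.P.2 + b • R.n₀)) (s : ℝ) :
    R.gap y s = R.gap R.P s + 2 * ((s - R.s₀) * b) * ⟪R.relPos R.P s, R.n₀⟫_ℝ +
      ((s - R.s₀) * b) ^ 2 * R.ε ^ 2 := by
  simp only [TwoBodyRecord.gap]
  rw [relPos_absorbed hy, norm_add_sq_real, norm_smul, inner_smul_right, mul_pow, Real.norm_eq_abs,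
    sq_abs, R.norm_n₀]
  ring

/-- The absorbed datum is in contact at the recorded instant. -/
theorem gap_absorbed_s₀ (hy : y = (R.P.1 - (R.s₀ * b) • R.n₀, R.P.2 + b • R.n₀)) :
    R.gap y R.s₀ = 0 := by
  rw [gap_absorbed hy, R.gap_P_s₀, sub_self]
  simp

/-- Distance of the absorbed datum to the record: at most `|b| ε (s₀ + 1)`. -/
theorem dist_absorbed_le (hy : y = (R.P.1 - (R.s₀ * b) • R.n₀, R.P.2 + b • R.n₀)) :
    dist y R.P ≤ |b| * (R.ε * (R.s₀ + 1)) := by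
  subst hy
  have hs₀ := R.s₀_pos
  have hε := R.ε_pos
  rw [Prod.dist_eq, max_le_iff, dist_eq_norm, dist_eq_norm]
  constructor
  · rw [show R.P.1 - (R.s₀ * b) • R.n₀ - R.P.1 = -((R.s₀ * b) • R.n₀) by abel, norm_neg, norm_smul,
      Real.norm_eq_abs, abs_mul, abs_of_pos hs₀, R.norm_n₀]
    nlinarith [abs_nonneg b]
  · rw [show R.P.2 + b • R.n₀ - R.P.2 = b • R.n₀ by abel, norm_smul, Real.norm_eq_abs, R.norm_n₀]
    exact mul_le_mul_of_nonneg_left (le_mul_of_one_le_right hε.le (by linarith)) (abs_nonneg b)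

/-- **No early contact**: before `s₀` the absorbed datum is apart from the exterior particle
(`gap > 0` on `[0, s₀)`), provided `|b| M ε < κ` (the linear growth `2κ (s₀ - s)` of the recorded gap
beats the tilt, `|⟪relPos P s, n₀⟫| ≤ M ε` on `[0, s₀ + 1]`). -/
theorem gap_absorbed_pos (hy : y = (R.P.1 - (R.s₀ * b) • R.n₀, R.P.2 + b • R.n₀))
    (hb : |b| * (R.M * R.ε) < R.κ) {s : ℝ} (hs0 : 0 ≤ s) (hs : s < R.s₀) : 0 < R.gap y s := by
  rw [gap_absorbed hy]
  have h1 := R.gap_P_ge s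
  have hM : ‖R.relPos R.P s‖ ≤ R.M := R.norm_relPos_P_le ⟨hs0, by linarith⟩
  have hin : |⟪R.relPos R.P s, R.n₀⟫_ℝ| ≤ R.M * R.ε := by
    refine (abs_real_inner_le_norm _ _).trans ?_
    rw [R.norm_n₀]
    exact mul_le_mul_of_nonneg_right hM R.ε_pos.le
  have h2 : 2 * ((s - R.s₀) * b) * ⟪R.relPos R.P s, R.n₀⟫_ℝ ≥ -(2 * (R.s₀ - s) * (|b| * (R.M * R.ε))) := by
    have : |((s - R.s₀) * b) * ⟪R.relPos R.P s, R.n₀⟫_ℝ| ≤ (R.s₀ - s) * (|b| * (R.M * R.ε)) := by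
      rw [abs_mul, abs_mul, abs_of_neg (by linarith : s - R.s₀ < 0), neg_sub, mul_assoc]
      exact mul_le_mul_of_nonneg_left (mul_le_mul_of_nonneg_left hin (abs_nonneg b)) (by linarith)
    have := neg_abs_le (((s - R.s₀) * b) * ⟪R.relPos R.P s, R.n₀⟫_ℝ)
    nlinarith
  have h3 : 0 ≤ ((s - R.s₀) * b) ^ 2 * R.ε ^ 2 := by positivity
  nlinarith [mul_pos (by linarith : 0 < R.s₀ - s) (by linarith : 0 < R.κ - |b| * (R.M * R.ε))]

/-- **The absorbed datum touches at the recorded instant**: `contactTime y_b = s₀`. -/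
theorem contactTime_absorbed (hy : y = (R.P.1 - (R.s₀ * b) • R.n₀, R.P.2 + b • R.n₀))
    (hb : |b| * (R.M * R.ε) < R.κ) : R.contactTime y = R.s₀ := by
  have hmem : R.s₀ ∈ {s : ℝ | 0 ≤ s ∧ R.gap y s ≤ 0} := ⟨R.s₀_pos.le, (gap_absorbed_s₀ hy).le⟩
  refine le_antisymm (csInf_le ⟨0, fun s hs => hs.1⟩ hmem) (le_csInf ⟨R.s₀, hmem⟩ fun s hs => ?_)
  by_contra h
  exact absurd hs.2 (not_le.2 (gap_absorbed_pos hy hb hs.1 (not_le.1 h)))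

/-- Position bookkeeping: the absorbed datum reaches the RECORDED position at `s₀`. -/
theorem fst_add_s₀_smul_absorbed (hy : y = (R.P.1 - (R.s₀ * b) • R.n₀, R.P.2 + b • R.n₀)) :
    y.1 + R.s₀ • y.2 = R.P.1 + R.s₀ • R.P.2 := by
  subst hy
  dsimp only
  module

/-- **Absorption**: the outgoing velocity of the window particle from the absorbed datum, at the
contact at `s₀`, is the RECORDED outgoing velocity (the absorption identity
`SlavedSync.reflectVel_fst_absorb` of the companion file: the extra normal velocity `b • n₀` goes to the
exterior partner). -/
theorem postVel_absorbed (hy : y = (R.P.1 - (R.s₀ * b) • R.n₀, R.P.2 + b • R.n₀)) :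
    postVel y R.Q R.s₀ = postVel R.P R.Q R.s₀ := by
  have h1 : (y.1 + R.s₀ • y.2) - (R.Q.1 + R.s₀ • R.Q.2) = R.n₀ := by
    rw [impact_eq]; exact relPos_absorbed_s₀ hy
  have h2 : (R.P.1 + R.s₀ • R.P.2) - (R.Q.1 + R.s₀ • R.Q.2) = R.n₀ := by
    rw [impact_eq]; rfl
  have h3 : y.2 = R.P.2 + b • R.n₀ := by subst hy; rfl
  rw [postVel, postVel, h1, h2, h3]
  -- the absorption identity `(reflectVel n (v + b • n, u)).1 = (reflectVel n (v, u)).1`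
  -- (`SlavedSync.reflectVel_fst_absorb` of the companion file, recomputed here to keep this file
  -- independent of it): the normal components are exchanged by the equal-mass law
  have hn : R.n₀ ≠ 0 := by
    intro h0
    have := R.norm_n₀
    rw [h0, norm_zero] at this
    exact R.ε_pos.ne this
  have hn2 : ‖R.n₀‖ ^ 2 ≠ 0 := pow_ne_zero 2 (norm_ne_zero_iff.2 hn)
  simp only [reflectVel]
  rw [show R.P.2 + b • R.n₀ - R.Q.2 = (R.P.2 - R.Q.2) + b • R.n₀ by abel, inner_add_left,
    inner_smul_left, real_inner_self_eq_norm_sq, RCLike.conj_to_real, add_div, mul_div_assoc,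
    div_self hn2, mul_one, add_smul]
  abel

/-- **After `s₀` the toy window path from the absorbed datum IS the record.** -/
theorem toyTraj_absorbed_eq_recPath (hy : y = (R.P.1 - (R.s₀ * b) • R.n₀, R.P.2 + b • R.n₀))
    (hb : |b| * (R.M * R.ε) < R.κ) (p : EuclideanSpace ℝ d × EuclideanSpace ℝ d) {s : ℝ}
    (hs : R.s₀ < s) : R.toyTraj p y p s = R.recPath p p s := by
  rw [toyTraj_self, contactTime_absorbed hy hb, collidePath_of_lt hs, R.recPath_self_of_lt p hs,
    postVel_absorbed hy, fst_add_s₀_smul_absorbed hy]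

/-- The absorbed datum differs from the record when `b ≠ 0`. -/
theorem absorbed_ne (hy : y = (R.P.1 - (R.s₀ * b) • R.n₀, R.P.2 + b • R.n₀)) (hb : b ≠ 0) :
    y ≠ R.P := by
  intro h
  have h2 : y.2 = R.P.2 := by rw [h]
  subst hy
  have hn : R.n₀ ≠ 0 := by
    intro h0
    have := R.norm_n₀
    rw [h0, norm_zero] at this
    exact R.ε_pos.ne this
  have : b • R.n₀ = 0 := by simpa using h2
  exact hb ((smul_eq_zero.1 this).resolve_right hn)

/-- **Headline — an absorbed segment lies on the toy plaque.** For every `b` with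
`|b| ε (s₀ + 1) ≤ δ₀` and `|b| M ε < κ`, the datum `y_b = (P.1 - (s₀ b) • n₀, P.2 + b • n₀)` is the
window datum of a slaved trajectory `z` of the toy (`IsSlavedTrajectory ε {p} {p, q} (recPath p) z`,
`z p 0 = y_b`) whose window path satisfies the exponential-convergence clause of `slavedUnstableSet`
in its exact (sup-metric, all large times) form — it coincides with the record after `s₀` — and EVERY
slaved trajectory of the toy with window datum `y_b` coincides with the record after `s₀`. With
`absorbed_ne`, the toy plaque through `P` contains a segment of distinct data (one absorbed dimension
per exterior contact). -/
theorem absorbed_segment_on_toy_plaque {p q : EuclideanSpace ℝ d × EuclideanSpace ℝ d} (hpq : p ≠ q)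
    (hy : y = (R.P.1 - (R.s₀ * b) • R.n₀, R.P.2 + b • R.n₀))
    (hbδ : |b| * (R.ε * (R.s₀ + 1)) ≤ R.δ₀) (hb : |b| * (R.M * R.ε) < R.κ) :
    (∃ z : (EuclideanSpace ℝ d × EuclideanSpace ℝ d) → ℝ → EuclideanSpace ℝ d × EuclideanSpace ℝ d,
      IsSlavedTrajectory R.ε ({p} : Set _) ({p, q} : Set _) (R.recPath p) z ∧ z p 0 = y ∧
      (∀ s : ℝ, R.s₀ < s → z p s = R.recPath p p s) ∧
      ∃ r : ℝ, 0 < r ∧ ∀ᶠ s : ℝ in atTop, dist (z p s) (R.recPath p p s) ≤ Real.exp (-(r * s))) ∧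
    ∀ z : (EuclideanSpace ℝ d × EuclideanSpace ℝ d) → ℝ → EuclideanSpace ℝ d × EuclideanSpace ℝ d,
      IsSlavedTrajectory R.ε ({p} : Set _) ({p, q} : Set _) (R.recPath p) z → z p 0 = y →
        ∀ s : ℝ, R.s₀ < s → z p s = R.recPath p p s := by
  have hyδ : dist y R.P ≤ R.δ₀ := (dist_absorbed_le hy).trans hbδ
  have hafter : ∀ s : ℝ, R.s₀ < s → R.toyTraj p y p s = R.recPath p p s := fun s hs =>
    toyTraj_absorbed_eq_recPath hy hb p hs
  refine ⟨⟨R.toyTraj p y, isSlavedTrajectory_toyTraj hpq hyδ, toyTraj_zero hyδ, hafter, 1, one_pos,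
    ?_⟩, fun z hz h0 s hs => ?_⟩
  · filter_upwards [eventually_gt_atTop R.s₀] with s hs
    rw [hafter s hs, dist_self]
    exact (Real.exp_pos _).le
  · rw [(eq_toyTraj hpq hyδ hz h0 (R.s₀_pos.le.trans hs.le)).1, hafter s hs]

end SlavedSync.Toy

end Summit.AtomisticToContinuum.HydrodynamicLimit.Theorems
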